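import Summits.Ventures.PercRepro.RankLevelSetExplicitSplitArith
import Summits.Ventures.PercRepro.RankLevelSetExplicitCells
import Summits.Ventures.PercRepro.RankLevelSetPlaneTen
import Summits.Ventures.PercRepro.RankLevelSetLevelSixAll
import Summits.Ventures.PercRepro.RankLevelSetDepCountSplit

/-!
# PercRepro — C-025 AT LEVEL `7` FOR EVERY FINITE MATROID AND EVERY `p ≥ 1,506,590,261` (p9, sub-claim S4.1 of the
crux `C025`; `proofs/SUBCLAIM-S4-p9.md`)

THEOREM P′'s recipe at `q = 7` with the cell's own constants instead of the local-sparsity ones: the split fibre count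
`ncard_eRk_eq_ncard_le_le_split` at `(q, f, f′) = (7, 87, 43)` — `f(6) ≤ 43` is the landed catalogue bound
(`ncard_le_fortythree_of_eRk_le_six_of_free`, RankLevelSetPlaneTen) and `f(7) ≤ 87` one cover step from it
(`ncard_le_eightyseven_of_free`) — so `σ_s ≤ 2^{36}`, `σ ≤ 2^{79}`; the `q = 6` row `c025_six_large`
(RankLevelSetLevelSixAll, `p ≥ 124,426`) is the `hprev` of `rls_succ_large 6 7 T7`; the core at coranks `8 … 135` is
`c025_core_seven_bounded` (`poly_seven`: the small term needs `16·2^{36}·7·36·2^{15} ≤ 4(p+1)²`, the big term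
`7^7·8·2^{79}·6·2^{15}·1080^5 ≤ (p+1)^7`), at coranks `≥ 136` `c025_core_explicit_large'` (`p ≥ 386`).
* **`c025_seven_explicit`** — `∀ M [M.Finite] p, T7 + 1 ≤ p → RLS M p 7`, `T7 = 1,506,590,260`;
* `c025_seven_explicit'` — the literal `C025` body at `(p, 7)`.
Against night-1's seat records at `q = 7` (`669,843,650` with the v1 count, `77,041` with the split count and the exact
per-corank arithmetic — neither in the tree) this is within `2.25×` of the first and is a TREE statement. Axioms: standard.
-/

open scoped Matroid

namespace PercRepro

namespace ThmN

open Set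

variable {α : Type}

namespace Explicit

/-- `f(7) ≤ 87` on the `e`-free core: one cover step (`ncard_le_two_mul_add_one_of_free`) from the landed catalogue
bound `f(6) ≤ 43` (`ncard_le_fortythree_of_eRk_le_six_of_free`, RankLevelSetPlaneTen). -/
theorem ncard_le_eightyseven_of_free (M : Matroid α) [M.Finite]
    (hfree : ∀ e ∈ M.E, ∃ A ⊆ M.E \ {e}, e ∉ M.closure A ∧ e ∉ M.closure ((M.E \ {e}) \ A)) :
    ∀ X ⊆ M.E, M.eRk X ≤ 7 → X.ncard ≤ 87 := by
  intro X hX hr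
  have := ncard_le_two_mul_add_one_of_free M hfree (k := 6) (B := 43)
    (fun _ hY hrY => ncard_le_fortythree_of_eRk_le_six_of_free M hfree hY hrY) X hX hr
  omega

/-- The level-`7` threshold `T7 = 1,506,590,260`: level `7` holds for every `p ≥ T7 + 1`. -/
def T7 : ℕ := 1506590260

/-- **(A5-iv, sharp, constant 4)** `8N ≤ 4·2^m·C` under `16·σ₀·(q'+2)(q'+1)²·2^{2(q'+2)+1} ≤ 4·(p+1)²`. -/
theorem N_term_bound_sharp4 (q' m p N σ₀ Cm Cn C : ℕ)
    (hN : N ≤ σ₀ * (q' + 1) * 2 ^ (2 * (q' + 2) + 1 + m) * Cm)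
    (h5 : (p + 1) ^ 2 * Cm ≤ (q' + 2) * (q' + 1) * Cn) (h3 : Cn ≤ 2 * C)
    (hsq : 16 * σ₀ * ((q' + 2) * (q' + 1) ^ 2) * 2 ^ (2 * (q' + 2) + 1) ≤ 4 * (p + 1) ^ 2) :
    8 * N ≤ 4 * 2 ^ m * C := by
  have hp2 : 0 < (p + 1) ^ 2 := by positivity
  apply Nat.le_of_mul_le_mul_right _ hp2
  have hsplit : 2 ^ (2 * (q' + 2) + 1 + m) = 2 ^ (2 * (q' + 2) + 1) * 2 ^ m := pow_add _ _ _
  calc 8 * N * (p + 1) ^ 2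
      ≤ 8 * (σ₀ * (q' + 1) * 2 ^ (2 * (q' + 2) + 1 + m) * Cm) * (p + 1) ^ 2 :=
        Nat.mul_le_mul_right _ (Nat.mul_le_mul_left _ hN)
    _ = 8 * σ₀ * (q' + 1) * 2 ^ (2 * (q' + 2) + 1 + m) * ((p + 1) ^ 2 * Cm) := by ring
    _ ≤ 8 * σ₀ * (q' + 1) * 2 ^ (2 * (q' + 2) + 1 + m) * ((q' + 2) * (q' + 1) * Cn) :=
        Nat.mul_le_mul_left _ h5
    _ ≤ 8 * σ₀ * (q' + 1) * 2 ^ (2 * (q' + 2) + 1 + m) * ((q' + 2) * (q' + 1) * (2 * C)) :=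
        Nat.mul_le_mul_left _ (Nat.mul_le_mul_left _ h3)
    _ = (16 * σ₀ * ((q' + 2) * (q' + 1) ^ 2) * 2 ^ (2 * (q' + 2) + 1)) * (2 ^ m * C) := by
        rw [hsplit]; ring
    _ ≤ (4 * (p + 1) ^ 2) * (2 ^ m * C) := Nat.mul_le_mul_right _ hsq
    _ = 4 * 2 ^ m * C * (p + 1) ^ 2 := by ring

/-- **The `(P_d)` at level `7`** with the split count (`σ_s ≤ 2^{36}` from `f′ = 43`, `σ ≤ 2^{79}` from `f = 87`),
corank `d = 8 + m ≤ 135`, `p ≥ T7`. -/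
theorem poly_seven (m p Ns Nb : ℕ) (hm : m + 1 ≤ 128) (hp : T7 ≤ p)
    (hNs : Ns ≤ 2 ^ 36 * 6 * 2 ^ (15 + m) * (p + (7 + 1 + m)).choose 5)
    (hNb : Nb ≤ 2 ^ 79 * 6 * 2 ^ (15 + m) * (8 * (8 + m)) ^ 5) :
    8 * ((p + (7 + 1 + m)).choose 7 + (Ns + Nb)) ≤ 7 * 2 ^ (m + 1) * (p + 7).choose 7 := by
  have h16m : 8 * (2 * 7 * (m + 1)) ≤ p + 1 := by unfold T7 at hp; omega
  obtain ⟨h2, h3⟩ := ratio_bounds 7 m p h16m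
  rw [show p + 7 + 1 + m = p + (7 + 1 + m) by ring] at h2 h3
  have h5 := choose_two_down (p + (7 + 1 + m)) 5 p (by omega)
  have hsq : 16 * 2 ^ 36 * ((5 + 2) * (5 + 1) ^ 2) * 2 ^ (2 * (5 + 2) + 1) ≤ 4 * (p + 1) ^ 2 := by
    have h := Nat.pow_le_pow_left (show T7 + 1 ≤ p + 1 by omega) 2
    calc 16 * 2 ^ 36 * ((5 + 2) * (5 + 1) ^ 2) * 2 ^ (2 * (5 + 2) + 1) ≤ 4 * (T7 + 1) ^ 2 := by
          unfold T7; norm_num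
      _ ≤ 4 * (p + 1) ^ 2 := Nat.mul_le_mul_left _ h
  have h6 : 8 * Ns ≤ 4 * 2 ^ m * (p + 7).choose 7 :=
    N_term_bound_sharp4 5 m p Ns (2 ^ 36) _ _ _ hNs h5 h3 hsq
  -- the big term: `8·Nb ≤ 2^m·C`
  have hbig : 8 * Nb ≤ 2 ^ m * (p + 7).choose 7 := by
    have hd : (8 * (8 + m)) ^ 5 ≤ 1080 ^ 5 := Nat.pow_le_pow_left (by omega) 5
    have hC : 2 ^ 79 * 6 * 2 ^ 15 * 1080 ^ 5 * 8 ≤ (p + 7).choose 7 := by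
      have hpow := pow_le_pow_mul_choose p 7
      have h7 : 0 < 7 ^ 7 := by positivity
      apply Nat.le_of_mul_le_mul_left _ h7
      have hT := Nat.pow_le_pow_left (show T7 + 1 ≤ p + 1 by omega) 7
      calc 7 ^ 7 * (2 ^ 79 * 6 * 2 ^ 15 * 1080 ^ 5 * 8) ≤ (T7 + 1) ^ 7 := by unfold T7; norm_num
        _ ≤ (p + 1) ^ 7 := hT
        _ ≤ 7 ^ 7 * (p + 7).choose 7 := hpow
    calc 8 * Nb ≤ 8 * (2 ^ 79 * 6 * 2 ^ (15 + m) * (8 * (8 + m)) ^ 5) := Nat.mul_le_mul_left _ hNb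
      _ ≤ 8 * (2 ^ 79 * 6 * 2 ^ (15 + m) * 1080 ^ 5) := Nat.mul_le_mul_left _ (Nat.mul_le_mul_left _ hd)
      _ = 2 ^ m * (2 ^ 79 * 6 * 2 ^ 15 * 1080 ^ 5 * 8) := by rw [pow_add]; ring
      _ ≤ 2 ^ m * (p + 7).choose 7 := Nat.mul_le_mul_left _ hC
  have h7 : 9 + (4 + 1) * 2 ^ m ≤ 7 * 2 ^ (m + 1) := by
    have : 1 ≤ 2 ^ m := Nat.one_le_two_pow
    rw [pow_succ]; omega
  calc 8 * ((p + (7 + 1 + m)).choose 7 + (Ns + Nb))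
      = 8 * (p + (7 + 1 + m)).choose 7 + 8 * Ns + 8 * Nb := by ring
    _ ≤ 9 * (p + 7).choose 7 + 4 * 2 ^ m * (p + 7).choose 7 + 2 ^ m * (p + 7).choose 7 :=
        Nat.add_le_add (Nat.add_le_add h2 h6) hbig
    _ = (9 + (4 + 1) * 2 ^ m) * (p + 7).choose 7 := by ring
    _ ≤ 7 * 2 ^ (m + 1) * (p + 7).choose 7 := Nat.mul_le_mul_right _ h7

end Explicit

/-- **The `e`-free core at level `7`, corank `8 ≤ d ≤ 135`, rank `p ≥ T7`** — the split count
`ncard_eRk_eq_ncard_le_le_split` at `(q, f, f′) = (7, 87, 43)`. -/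
theorem c025_core_seven_bounded (M : Matroid α) [M.Finite] (p d : ℕ) (hp : Explicit.T7 ≤ p) (hd1 : 8 ≤ d)
    (hd2 : d ≤ 135) (hR : M.eRank = (p : ℕ∞)) (hn : M.E.ncard = p + d)
    (hfree : ∀ e ∈ M.E, ∃ A ⊆ M.E \ {e}, e ∉ M.closure A ∧ e ∉ M.closure ((M.E \ {e}) \ A)) :
    RLS M p 7 := by
  classical
  obtain ⟨m, rfl⟩ : ∃ m, d = 7 + 1 + m := ⟨d - 8, by omega⟩
  have hp' : 1506590260 ≤ p := hp
  have hEcard : M.ground_finite.toFinset.card = p + (7 + 1 + m) := by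
    rw [← Set.ncard_eq_toFinset_card _ M.ground_finite]; exact hn
  have hL : ∀ e ∈ M.E, ¬ M.IsLoop e := not_isLoop_of_free M hfree
  have hs : ∀ e ∈ M.E, ∀ f ∈ M.E, e ≠ f → M.eRk {e, f} = 2 := by
    intro e he f hf hef
    have h2 : (2 : ℕ∞) ≤ M.eRk {e, f} :=
      two_le_eRk_of_two_le_ncard_of_free M hfree (pair_subset he hf) (by rw [ncard_pair hef])
    have h3 : M.eRk {e, f} ≤ 2 := by
      have := M.eRk_le_encard {e, f}
      rwa [encard_pair hef] at this
    exact le_antisymm h3 h2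
  have hcirc : ∀ C, M.IsCircuit C → 3 ≤ C.encard := three_le_encard_of_circuit M hL hs
  have hflat : ∀ X ⊆ M.E, M.eRk X ≤ 7 → X.ncard ≤ 87 := Explicit.ncard_le_eightyseven_of_free M hfree
  have hflat' : ∀ X ⊆ M.E, M.eRk X ≤ ((7 - 1 : ℕ) : ℕ∞) → X.ncard ≤ 43 :=
    fun X hX hr => ncard_le_fortythree_of_eRk_le_six_of_free M hfree hX hr
  have hd : M.E.encard = M.eRank + ((7 + 1 + m : ℕ) : ℕ∞) := by
    rw [hR, ← M.ground_finite.cast_ncard_eq, hn]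
    push_cast
    ring
  have hU1 := Matroid.topCount_le_ncard_compl (M := M) hR hd 7
  have hU2 := Matroid.ncard_eRk_eq_ncard_le_le_split M 7 87 43 (by norm_num) hcirc hflat hflat' hd
  rw [hn] at hU2
  have hσs : ∑ j ∈ Finset.range (7 + 1 + m - (7 + 1) + 1), Nat.choose (43 - 7) j ≤ 2 ^ 36 :=
    Explicit.sum_range_choose_le_two_pow _ _
  have hσ : ∑ j ∈ Finset.range (7 + 1 + m - (7 + 1) + 1), Nat.choose (87 - (7 + 1)) j ≤ 2 ^ 79 :=
    Explicit.sum_range_choose_le_two_pow _ _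
  have hhalf : 5 ≤ (p + (7 + 1 + m)) / 2 := by omega
  have hsk : ∀ k ∈ Finset.Icc 3 (7 + 1), {C | M.IsCircuit C ∧ C.ncard = k}.ncard ≤ 2 ^ (2 * 7 + 1 + m) := by
    intro k hk
    rw [Finset.mem_Icc] at hk
    have hc : {C | M.IsCircuit C ∧ C.ncard = k}.ncard ≤ (7 + 1 + m + (k - 1)).choose k := by
      have := Matroid.ncard_circuits_le_choose_of_encard M hd (k - 1)
      rw [show k - 1 + 1 = k by omega] at this
      exact this
    exact hc.trans ((Nat.choose_le_two_pow _ _).trans (Nat.pow_le_pow_right (by norm_num) (by omega)))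
  have hsum : ∑ k ∈ Finset.Icc 3 (7 + 1),
      {C | M.IsCircuit C ∧ C.ncard = k}.ncard * (p + (7 + 1 + m)).choose (7 + 1 - k) ≤
        (7 - 1) * (2 ^ (2 * 7 + 1 + m) * (p + (7 + 1 + m)).choose (7 - 2)) := by
    calc ∑ k ∈ Finset.Icc 3 (7 + 1),
          {C | M.IsCircuit C ∧ C.ncard = k}.ncard * (p + (7 + 1 + m)).choose (7 + 1 - k)
        ≤ ∑ _k ∈ Finset.Icc 3 (7 + 1), 2 ^ (2 * 7 + 1 + m) * (p + (7 + 1 + m)).choose (7 - 2) := by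
          apply Finset.sum_le_sum
          intro k hk
          have hk' := hk
          rw [Finset.mem_Icc] at hk'
          have hmono : (p + (7 + 1 + m)).choose (7 + 1 - k) ≤ (p + (7 + 1 + m)).choose (7 - 2) :=
            Explicit.choose_le_choose_of_le_half _ _ _ (by omega) hhalf
          exact Nat.mul_le_mul (hsk k hk) hmono
      _ = (7 - 1) * (2 ^ (2 * 7 + 1 + m) * (p + (7 + 1 + m)).choose (7 - 2)) := by
          rw [Finset.sum_const, Nat.card_Icc, smul_eq_mul]
  have hsumb : ∑ k ∈ Finset.Icc 3 (7 + 1),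
      {C | M.IsCircuit C ∧ C.ncard = k}.ncard * ((7 + 1) * (7 + 1 + m)).choose (7 + 1 - k) ≤
        (7 - 1) * (2 ^ (2 * 7 + 1 + m) * ((7 + 1) * (7 + 1 + m)) ^ (7 - 2)) := by
    calc ∑ k ∈ Finset.Icc 3 (7 + 1),
          {C | M.IsCircuit C ∧ C.ncard = k}.ncard * ((7 + 1) * (7 + 1 + m)).choose (7 + 1 - k)
        ≤ ∑ _k ∈ Finset.Icc 3 (7 + 1), 2 ^ (2 * 7 + 1 + m) * ((7 + 1) * (7 + 1 + m)) ^ (7 - 2) := by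
          apply Finset.sum_le_sum
          intro k hk
          have hk' := hk
          rw [Finset.mem_Icc] at hk'
          have hpos : 1 ≤ (7 + 1) * (7 + 1 + m) := by omega
          have hmono : ((7 + 1) * (7 + 1 + m)).choose (7 + 1 - k) ≤ ((7 + 1) * (7 + 1 + m)) ^ (7 - 2) :=
            (Nat.choose_le_pow _ _).trans (Nat.pow_le_pow_right hpos (by omega))
          exact Nat.mul_le_mul (hsk k hk) hmono
      _ = (7 - 1) * (2 ^ (2 * 7 + 1 + m) * ((7 + 1) * (7 + 1 + m)) ^ (7 - 2)) := by
          rw [Finset.sum_const, Nat.card_Icc, smul_eq_mul]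
  set Ns : ℕ := (∑ j ∈ Finset.range (7 + 1 + m - (7 + 1) + 1), Nat.choose (43 - 7) j) *
    ∑ k ∈ Finset.Icc 3 (7 + 1),
      {C | M.IsCircuit C ∧ C.ncard = k}.ncard * (p + (7 + 1 + m)).choose (7 + 1 - k) with hNs
  set Nb : ℕ := (∑ j ∈ Finset.range (7 + 1 + m - (7 + 1) + 1), Nat.choose (87 - (7 + 1)) j) *
    ∑ k ∈ Finset.Icc 3 (7 + 1),
      {C | M.IsCircuit C ∧ C.ncard = k}.ncard * ((7 + 1) * (7 + 1 + m)).choose (7 + 1 - k) with hNb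
  have hNs' : Ns ≤ 2 ^ 36 * 6 * 2 ^ (15 + m) * (p + (7 + 1 + m)).choose 5 := by
    calc Ns ≤ 2 ^ 36 * ((7 - 1) * (2 ^ (2 * 7 + 1 + m) * (p + (7 + 1 + m)).choose (7 - 2))) :=
          Nat.mul_le_mul hσs hsum
      _ = _ := by ring
  have hNb' : Nb ≤ 2 ^ 79 * 6 * 2 ^ (15 + m) * (8 * (8 + m)) ^ 5 := by
    calc Nb ≤ 2 ^ 79 * ((7 - 1) * (2 ^ (2 * 7 + 1 + m) * ((7 + 1) * (7 + 1 + m)) ^ (7 - 2))) :=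
          Nat.mul_le_mul hσ hsumb
      _ = _ := by ring
  have hU : Matroid.topCount M p 7 ≤ (p + (7 + 1 + m)).choose 7 + (Ns + Nb) := by
    refine hU1.trans (hU2.trans ?_)
    rw [hNs, hNb]; omega
  -- (Y)
  have hY := Matroid.two_pow_le_midCount_add (M := M) p 7 hR
  have hA : {X : Set α | X ⊆ M.E ∧ M.eRk X ≤ 7}.ncard ≤
      ∑ j ∈ Finset.range (87 + 1), (p + (7 + 1 + m)).choose j := by
    calc {X : Set α | X ⊆ M.E ∧ M.eRk X ≤ 7}.ncard
        ≤ {X : Set α | X ⊆ (M.ground_finite.toFinset : Set α) ∧ X.ncard ≤ 87}.ncard := by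
          apply ncard_le_ncard
          · intro X hX
            exact ⟨by rw [Set.Finite.coe_toFinset]; exact hX.1, hflat X hX.1 hX.2⟩
          · exact (Finset.finite_toSet _).finite_subsets.subset (fun X hX => hX.1)
      _ ≤ ∑ j ∈ Finset.range (87 + 1), M.ground_finite.toFinset.card.choose j :=
          ncard_subsets_ncard_le _ 87
      _ = ∑ j ∈ Finset.range (87 + 1), (p + (7 + 1 + m)).choose j := by rw [hEcard]
  have hB := Matroid.ncard_spanning_le (M := M) hd
  rw [hEcard] at hY hB
  have hT : 16 * ∑ j ∈ Finset.range (135 + 1), (p + (7 + 1 + m)).choose j ≤ 2 ^ (p + (7 + 1 + m)) :=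
    Explicit.sixteen_mul_sum_range_choose_le 135 (p + (7 + 1 + m)) (by omega)
  have hA' : ∑ j ∈ Finset.range (87 + 1), (p + (7 + 1 + m)).choose j ≤
      ∑ j ∈ Finset.range (135 + 1), (p + (7 + 1 + m)).choose j :=
    Finset.sum_le_sum_of_subset_of_nonneg (Finset.range_mono (by omega)) (fun _ _ _ => Nat.zero_le _)
  have hB' : ∑ j ∈ Finset.range (7 + 1 + m + 1), (p + (7 + 1 + m)).choose j ≤
      ∑ j ∈ Finset.range (135 + 1), (p + (7 + 1 + m)).choose j :=
    Finset.sum_le_sum_of_subset_of_nonneg (Finset.range_mono (by omega)) (fun _ _ _ => Nat.zero_le _)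
  have hAB : 8 * ({X : Set α | X ⊆ M.E ∧ M.eRk X ≤ 7}.ncard +
      {X : Set α | X ⊆ M.E ∧ M.eRk X = M.eRank}.ncard) ≤ 2 ^ (p + (7 + 1 + m)) := by
    have h1 := hA.trans hA'
    have h2 := hB.trans hB'
    omega
  have hΦ := phiK_le_two_pow_div p 7
  rw [Nat.choose_symm_add] at hΦ
  have hpoly := Explicit.poly_seven m p Ns Nb (by omega) hp hNs' hNb'
  rw [RLS_iff]
  have hUq : (Matroid.topCount M p 7 : ℚ) ≤ ((p + (7 + 1 + m)).choose 7 : ℚ) + ((Ns + Nb : ℕ) : ℚ) := by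
    exact_mod_cast hU
  have hYq : (2 : ℚ) ^ (p + (7 + 1 + m)) ≤ (Matroid.midCount M p 7 : ℚ) +
      ({X : Set α | X ⊆ M.E ∧ M.eRk X ≤ 7}.ncard : ℚ) +
      ({X : Set α | X ⊆ M.E ∧ M.eRk X = M.eRank}.ncard : ℚ) := by exact_mod_cast hY
  have hABq : 8 * (({X : Set α | X ⊆ M.E ∧ M.eRk X ≤ 7}.ncard : ℚ) +
      ({X : Set α | X ⊆ M.E ∧ M.eRk X = M.eRank}.ncard : ℚ)) ≤ 2 ^ (p + (7 + 1 + m)) := by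
    exact_mod_cast hAB
  have hpolyq : 8 * (((p + (7 + 1 + m)).choose 7 : ℚ) + ((Ns + Nb : ℕ) : ℚ)) ≤
      7 * 2 ^ (7 + 1 + m - 7) * ((p + 7).choose 7 : ℚ) := by
    rw [show 7 + 1 + m - 7 = m + 1 by omega]
    exact_mod_cast hpoly
  have hU0 : (0 : ℚ) ≤ (Matroid.topCount M p 7 : ℚ) := Nat.cast_nonneg _
  exact level_arith (p := p) (d := 7 + 1 + m) (n := p + (7 + 1 + m)) (q := 7) rfl (by omega) hΦ hU0 hUq hYq
    hABq hpolyq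

/-- **C-025 AT LEVEL `7` FOR EVERY FINITE MATROID AND EVERY `p ≥ 1,506,590,261`** — unconditional (the `q = 6` row
`c025_six_large`, RankLevelSetLevelSixAll, is the `hprev` of `rls_succ_large 6 7 T7`; the core at coranks `8 … 135` is
`c025_core_seven_bounded`, at coranks `≥ 136` `c025_core_explicit_large'`). -/
theorem c025_seven_explicit (M : Matroid α) [M.Finite] (p : ℕ) (hp : Explicit.T7 + 1 ≤ p) : RLS M p 7 := by
  have hp' : 1506590261 ≤ p := hp
  refine rls_succ_large (α := α) 6 7 Explicit.T7 ?_ ?_ ?_ M p hp (by omega)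
  · intro M' _ p' hP _
    exact c025_six_large M' p' (by unfold Explicit.T7 at hP; omega)
  · intro M' _ p' _ hn _
    rcases Nat.lt_or_ge M'.E.ncard (p' + 7) with h | h
    · exact RLS_of_ncard_lt M' h
    · exact RLS_of_ncard_eq M' (by omega)
  · intro M' _ p' hP hR hbig _ hfree
    rcases Nat.lt_or_ge M'.E.ncard (p' + 136) with h | h
    · exact c025_core_seven_bounded M' p' (M'.E.ncard - p') hP (by omega) (by omega) hR (by omega) hfree
    · exact c025_core_explicit_large' 7 (by norm_num) M' p' (by unfold Explicit.T7 at hP; norm_num; omega) hR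
        (by norm_num; omega) hfree

/-- The level-`7` statement in the literal `C025` body. -/
theorem c025_seven_explicit' (M : Matroid α) [M.Finite] (p : ℕ) (hp : 1506590261 ≤ p) :
    phiK p 7 * ({A : Set α | A ⊆ M.E ∧ M.eRk A = (p : ℕ∞) ∧ M.eRk (M.E \ A) = (7 : ℕ∞)}.ncard : ℚ) ≤
      ({A : Set α | A ⊆ M.E ∧ (7 : ℕ∞) < M.eRk A ∧ M.eRk A < (p : ℕ∞)}.ncard : ℚ) :=
  c025_seven_explicit M p hp

end ThmN

end PercRepro
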